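import Literature.NumberTheory.EllipticCurves.CongruenceVisibilityComparison
import Literature.NumberTheory.EllipticCurves.TateUniformisation
import Literature.NumberTheory.EllipticCurves.TateParametrisationTorsion
import HarnessLib

/-!
# Visible elements of `Ш(E/K)[p]` from a `p`-congruent curve, IV: places of split multiplicative reduction

`Proofs`-style file (theorems only: no definition, no new named fact) in topic
`NumberTheory/EllipticCurves`, companion of `CongruenceVisibility.lean`,
`CongruenceVisibilityLocalFactors.lean` and `CongruenceVisibilityComparison.lean`. Written for the
cell `b2b-bsdres` (run/shared/lean/b2b/bsd-rank1-residual/), whose HONEST FRAMING applies to its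
use there: the goal of that cell is to DELETE the COMBINATION-SHAPED residual classes for ALL
analytic-rank `≤ 1` elliptic curves over `ℚ` — "full BSD formula for every rank `≤ 1` curve in
class C" assembled STRICTLY from published theorems — so that the rank-`≤ 1` remainder becomes
exactly the CONSTRUCTION-SHAPED classes, which are TYPED (missing-input `Prop`s), NOT attempted;
this is not "finishing BSD". The theorems below sharpen ONE per-curve certificate shape
(visibility); they are general and cell-independent.

## The theorem

`WeierstrassCurve.h1Equiv_mem_selmerLocalKer_of_hasSplitMultiplicativeReductionAt`: let `E = W`,
`E' = W'` be elliptic curves over a number field `K`, `p` a prime, `θ : E'[p] ⥲ E[p]` a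
`Γ_K`-isomorphism with transport `θ_*` on `H¹(K, ·)`, and `v` a finite place — of ANY residue
characteristic, `v ∣ p` allowed — at which BOTH curves have split multiplicative reduction, with
`#E(K_v)[p] ≤ p`. Then `θ_* 𝓢_v(E') ≤ 𝓢_v(E)`: a class of `H¹(K, E'[p])` satisfying the local
Selmer condition of `E'` at `v` transports to a class satisfying the local Selmer condition of `E`
at `v`; i.e. the comparison index `ι_v(θ)` of `CongruenceVisibilityComparison.lean` is `1`
(`relIndex_map_selmerLocalKer_eq_one_of_hasSplitMultiplicativeReductionAt`), and the place `v`
costs NOTHING in the visibility count — whereas the crude count of `CongruenceVisibility.lean`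
charges `#𝓛_v(E') = #E'(K_v)[p] · #(𝓞_v/p)` (a factor `p` at `v ∣ p` even when `E'(K_v)[p] = 0`,
and a factor `p` at every multiplicative `v ∤ p` with `K_v`-rational `p`-torsion, which at `p = 3`
over `ℚ` is EVERY split multiplicative prime `v ≡ 1 (mod 3)`). Packaged form:
`exists_sha_ne_zero_of_congr_of_rank_of_split` — `E(K)` finite of order prime to `p`, `p` odd, a
`p`-congruent `E'` of rank `≥ 1`, and at each place of `S` either (`v ∤ p` and `E'(K_v)[p] = 0`) or
(both curves split multiplicative at `v` and `#E(K_v)[p] ≤ p`) ⇒ `Ш(E/K)[p] ≠ 0`.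

CONDITIONAL on ONE named fact: `Literature.NumberTheory.EllipticCurves.Silverman1994_thmV53_tateUniformisation`
(Tate's `v`-adic uniformisation `K̄_v^*/q^ℤ ⥲ E(K̄_v)` at a place of split multiplicative
reduction; J. H. Silverman, *Advanced Topics in the Arithmetic of Elliptic Curves*, GTM 151, Ch. V,
Thm. 3.1 (c), (d) and Thm. 5.3 (a), (b); file `TateUniformisation.lean`), taken as the hypothesis
`hU`.

## Proof

Let `Φ : K̄_v^* → E(K̄_v)`, `Φ' : K̄_v^* → E'(K̄_v)` be Tate parametrisations (kernels `q^ℤ`,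
`q'^ℤ`). (1) A class `c = [φ] ∈ 𝓢_v(E')` is locally a coboundary in `E'(K̄_v)`: `φ(σ) = σa' − a'`
on `Γ_{K_v}`; `P' = p a'` is `K_v`-rational, so `P' = Φ'(u)` with `u ∈ K_v^*` (V.3.1 (d)); with
`w^p = u`, `R' = Φ'(w)` and the `p`-torsion point `T = a' − R'` one gets
`φ(σ) = Φ'(σw/w) + (σT − T)` with `σw/w ∈ μ_p` (`σ` fixes `u`). (2) The lines: for a primitive
`p`-th root of unity `ζ₀`, the point `G(Φ'(ζ₀))` — `G` = torsion comparison, `θ`, and the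
embedding `E[p](K̄) → E(K̄_v)` — and `Φ(ζ₀)` are non-zero `p`-torsion points of `E(K̄_v)` on which
`Γ_{K_v}` acts through the cyclotomic character mod `p`; `exists_eq_nsmul_or_forall_smul_eq`: either
`G(Φ'(ζ₀)) = a Φ(ζ₀)` for some `a`, or the two lines span `E[p]`, `Γ_{K_v}` acts on `E[p]` by
scalars, and comparing with `σΦ(w₀) − Φ(w₀) = Φ(σw₀/w₀) ∈ Φ(μ_p)` for `w₀^p = q` forces the scalars
to be `1`, i.e. all of `E[p]` is `K_v`-rational — excluded by `#E(K_v)[p] ≤ p`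
(`sq_le_card_ker_nsmul_of_forall_smul_eq`, Galois descent to Mathlib's `K_v`-points). (3) Hence
`G(Φ'(ζ)) = Φ(ζ^a)` on `μ_p`, and `θφ(σ) = Φ((σw/w)^a) + (σ θT − θT) = σb − b` with
`b = Φ(w^a) + θT ∈ E(K̄_v)`: the transported class dies in `H¹(K_v, E)`. The same argument covers
the non-split case through the twisted uniformisation of Silverman V.5.4 (not vendored; TODO).

## Provenance

The statement "congruent Tate curves have the same local Kummer condition" is implicit in the
local analysis of visibility (A. Agashe, W. Stein, J. Number Theory 97 (2002) §3.5, Case 2 via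
component groups, under `p ∤ N`) and in the comparison of Selmer groups of congruent curves
(e.g. B. Mazur, K. Rubin, *Kolyvagin systems* §2.3; Kramer / Mazur–Rubin-type local comparisons);
we know no numbered printed statement in the form needed at `p ∣ N` and prove it here from
Tate's uniformisation. Presearch (cell NOTES): corpus + galaxy queries "local Kummer condition
congruent elliptic curves multiplicative", "Selmer companion", "visibility multiplicative
reduction" — no verbatim statement; nearest: Mazur–Rubin, *Selmer companion curves* (Trans. AMS
2015; local conditions of curves with `E[m] ≅ E'[m]`, requiring in general `E[p^{k+1}] ≅ E'[p^{k+1}]`).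

## References

* [SilvermanATAEC1994] J. H. Silverman, *Advanced Topics in the Arithmetic of Elliptic Curves*,
  GTM 151 (1994), Ch. V, Thm. 3.1, Thm. 5.3, Cor. 5.4.
* [CremonaMazur2000] J. E. Cremona, B. Mazur, Experiment. Math. 9 (2000) 13–28, §3.
* [AgasheStein2002] A. Agashe, W. Stein, J. Number Theory 97 (2002) 171–185, Thm. 3.1, §3.5.
* [MazurRubin2004] B. Mazur, K. Rubin, *Kolyvagin systems*, Mem. AMS 799 (2004), §2.3.
* [SilvermanAEC2009] J. H. Silverman, *The Arithmetic of Elliptic Curves*, 2nd ed., III.6.4, VIII.§2, X.§4.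
-/

noncomputable section

open scoped Classical

open NumberField IsDedekindDomain Field

namespace WeierstrassCurve

open Literature.NumberTheory.EllipticCurves Literature.NumberTheory.GaloisRepresentations Field
open NumberField IsDedekindDomain

section Local

variable {K : Type} [Field K] [NumberField K] (W : WeierstrassCurve K) [W.IsElliptic]
  {p : ℕ} [hp : Fact p.Prime] (v : HeightOneSpectrum (𝓞 K))



/-- **The local Kummer conditions of two `p`-congruent curves agree at a place where both have
split multiplicative reduction.** Let `E = W`, `E' = W'` be elliptic curves over a number field
`K`, `θ : E'[p] ≃ E[p]` a `Γ_K`-isomorphism, and `v` a finite place (ANY residue characteristic,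
`v ∣ p` allowed) at which both curves have split multiplicative reduction; assume
`#E(K_v)[p] ≤ p`. Then every class of `H¹(K, E'[p])` satisfying the local Selmer condition of `E'`
at `v` transports under `θ_*` to a class satisfying the local Selmer condition of `E` at `v`
(`θ_* 𝓢_v(E') ≤ 𝓢_v(E)`, i.e. the comparison index `ι_v(θ)` of
`CongruenceVisibilityComparison.lean` is `1`). Conditional on the named fact
`Silverman1994_thmV53_tateUniformisation` (Tate's uniformisation, Silverman *ATAEC* V.3.1/V.5.3).
Proof: with Tate parametrisations `Φ, Φ'` of `E, E'` at `v`, a class Selmer for `E'` at `v` is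
locally the Kummer class of a point `P' = Φ'(u)`, `u ∈ K_v^*`, i.e. `σ ↦ Φ'(σw/w)` (`w^p = u`) up to
a coboundary, with `σw/w ∈ μ_p`; `θ` carries the line `Φ'(μ_p)` onto the line `Φ(μ_p)` as
`ζ ↦ ζ^a` (`exists_eq_nsmul_or_forall_smul_eq`; the alternative "all of `E[p]` is `K_v`-rational"
is excluded by `#E(K_v)[p] ≤ p`), so the transported class is locally the Kummer class of
`Φ(u^a) ∈ E(K_v)`, hence Selmer for `E`. [cite: SilvermanATAEC1994, Ch. V Thm. 3.1 (c),(d), Thm. 5.3]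
[cite: CremonaMazur2000, §3] -/
theorem h1Equiv_mem_selmerLocalKer_of_hasSplitMultiplicativeReductionAt
    (hU : Silverman1994_thmV53_tateUniformisation.{0})
    (W' : WeierstrassCurve K) [W'.IsElliptic]
    (θ : geomTorsion W' (p : ℤ) ≃+ geomTorsion W (p : ℤ))
    (hθ : ∀ (σ : absoluteGaloisGroup K) (P : geomTorsion W' (p : ℤ)), θ (σ • P) = σ • θ P)
    (hW : W.HasSplitMultiplicativeReductionAt v) (hW' : W'.HasSplitMultiplicativeReductionAt v)
    (hcard : Nat.card (nsmulAddMonoidHom p : (W.baseChange (v.adicCompletion K)).toAffine.Point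
        →+ _).ker ≤ p)
    {c : galH1Torsion W' (p : ℤ)} (hc : c ∈ selmerLocalKer W' (v.adicCompletion K) (p : ℤ)) :
    h1Equiv θ hθ c ∈ selmerLocalKer W (v.adicCompletion K) (p : ℤ) := by
  have hpp : p.Prime := hp.out
  haveI : NeZero p := ⟨hpp.ne_zero⟩
  haveI : CharZero (v.adicCompletion K) := charZero_adicCompletion v
  haveI : CharZero (AlgebraicClosure (v.adicCompletion K)) := charZero_of_injective_algebraMap
      (algebraMap (v.adicCompletion K) (AlgebraicClosure (v.adicCompletion K))).injective
  have hn : (p : ℤ) ≠ 0 := by exact_mod_cast hpp.ne_zero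
  -- Tate parametrisations of `E` and `E'` at `v`
  obtain ⟨q, Φ, hq0, hq1, -, hker, hequiv₀, -⟩ := hU W v hW
  obtain ⟨q', Φ', hq0', hq1', -, hker', hequiv₀', hrat'⟩ := hU W' v hW'
  have hequiv : ∀ (σ : (absoluteGaloisGroup (v.adicCompletion K))) (u : (AlgebraicClosure
      (v.adicCompletion K))ˣ),
      σ • Φ (Additive.ofMul u) = Φ (Additive.ofMul (Units.map
          (absoluteGaloisGroup.toAlgEquiv _ σ : AlgebraicClosure (v.adicCompletion K) →* AlgebraicClosure (v.adicCompletion K)) u)) :=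
    fun σ u ↦ hequiv₀ σ u
  have hequiv' : ∀ (σ : (absoluteGaloisGroup (v.adicCompletion K))) (u : (AlgebraicClosure
      (v.adicCompletion K))ˣ),
      σ • Φ' (Additive.ofMul u) = Φ' (Additive.ofMul (Units.map
          (absoluteGaloisGroup.toAlgEquiv _ σ : AlgebraicClosure (v.adicCompletion K) →* AlgebraicClosure (v.adicCompletion K)) u)) :=
    fun σ u ↦ hequiv₀' σ u
  -- a primitive `p`-th root of unity `ζ₀ = Z`
  obtain ⟨ζ₀, hζ₀⟩ := HasEnoughRootsOfUnity.exists_primitiveRoot (AlgebraicClosure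
      (v.adicCompletion K)) p
  have hZu : IsUnit ζ₀ := hζ₀.isUnit hpp.ne_zero
  set Z : (AlgebraicClosure (v.adicCompletion K))ˣ := hZu.unit with hZdef
  have hZ : IsPrimitiveRoot (Z : (AlgebraicClosure (v.adicCompletion K))) p := by
    rw [hZdef, IsUnit.unit_spec]; exact hζ₀
  have hZp : Z ^ p = 1 :=
    Units.ext (by rw [Units.val_pow_eq_pow_val, hZ.pow_eq_one, Units.val_one])
  -- the torsion comparison `E'[p](K̄) ≃ E'(K̄_v)[p]` and the transport `G = pointsMap ∘ θ ∘ e'⁻¹`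
  set e' := W'.torsionPointsEquiv (p : ℤ) (E := (v.adicCompletion K)) hn with he'
  set G : AddSubgroup.torsionBy (localPoints W' (v.adicCompletion K)) (p : ℤ) →+ localPoints W
      (v.adicCompletion K) :=
    ((pointsMap W (v.adicCompletion K)).comp (geomTorsion W (p : ℤ)).subtype).comp
      (θ.toAddMonoidHom.comp e'.symm.toAddMonoidHom) with hG
  have hG_apply : ∀ T, G T = pointsMap W (v.adicCompletion K) ((θ (e'.symm T) : geomTorsion W
      (p : ℤ)) :
      geomPoints W) := fun T ↦ rfl
  have hGsmul : ∀ (σ : (absoluteGaloisGroup (v.adicCompletion K))) (T : AddSubgroup.torsionBy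
      (localPoints W' (v.adicCompletion K)) (p : ℤ)),
      G (σ • T) = σ • G T := by
    intro σ T
    rw [hG_apply, hG_apply, he', torsionPointsEquiv_symm_smul, hθ,
      Literature.NumberTheory.EllipticCurves.AddSubgroup.torsionBy.coe_smul, pointsMap_smul]
  -- `Φ'(μ_p) ⊆ E'(K̄_v)[p]`; the point `L₂ = G(Φ'(ζ₀))`
  have hmem' : ∀ {ζ : (AlgebraicClosure (v.adicCompletion K))ˣ}, ζ ^ p = 1 →
      Φ' (Additive.ofMul ζ) ∈ AddSubgroup.torsionBy (localPoints W' (v.adicCompletion K)) (p : ℤ) :=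
    fun hζ ↦ (Submodule.mem_torsionBy_iff _ _).mpr
        (W'.zsmul_map_ofMul_eq_zero_of_pow_eq_one v Φ' hζ)
  set XZ : AddSubgroup.torsionBy (localPoints W' (v.adicCompletion K)) (p : ℤ) := ⟨Φ'
      (Additive.ofMul Z), hmem' hZp⟩
    with hXZ
  have hL₂p : (p : ℤ) • G XZ = 0 := by
    have h0 : (p : ℤ) • XZ = 0 := Subtype.ext (by
      rw [AddSubgroupClass.coe_zsmul, hXZ, AddSubgroup.coe_zero]
      exact W'.zsmul_map_ofMul_eq_zero_of_pow_eq_one v Φ' hZp)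
    rw [← map_zsmul, h0, map_zero]
  have hL₂σ : ∀ (σ : (absoluteGaloisGroup (v.adicCompletion K))) (c : ℕ), Units.map
      (absoluteGaloisGroup.toAlgEquiv _ σ : AlgebraicClosure (v.adicCompletion K) →* AlgebraicClosure (v.adicCompletion K)) Z = Z ^ c
      → σ • G XZ = c • G XZ := by
    intro σ c hc
    have h1 : σ • XZ = c • XZ := Subtype.ext (by
      rw [Literature.NumberTheory.EllipticCurves.AddSubgroup.torsionBy.coe_smul,
        AddSubgroupClass.coe_nsmul, hXZ]
      change σ • Φ' (Additive.ofMul Z) = c • Φ' (Additive.ofMul Z)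
      rw [hequiv', hc, ofMul_pow, map_nsmul])
    rw [← hGsmul, h1, map_nsmul]
  -- the dichotomy: either `θ` matches the lines `Φ'(μ_p) ↦ Φ(μ_p)` as `ζ ↦ ζ^a`, or all of `E[p]`
  -- is `K_v`-rational, which `#E(K_v)[p] ≤ p` forbids
  rcases W.exists_eq_nsmul_or_forall_smul_eq v hq0 hq1 Φ hker hequiv hZ hL₂p hL₂σ with
    ⟨a, ha⟩ | hfix
  swap
  · exfalso
    have h1 := W.sq_le_card_ker_nsmul_of_forall_smul_eq v hfix
    have h2 : p < p ^ 2 := by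
      have := hpp.two_le
      nlinarith
    omega
  have hclaim : ∀ (ζ : (AlgebraicClosure (v.adicCompletion K))ˣ) (hζ : ζ ^ p = 1),
      G ⟨Φ' (Additive.ofMul ζ), hmem' hζ⟩ = Φ (Additive.ofMul (ζ ^ a)) := by
    intro ζ hζ
    obtain ⟨k, -, hk⟩ := hZ.eq_pow_of_pow_eq_one (ξ := (ζ : (AlgebraicClosure
        (v.adicCompletion K))))
      (by rw [← Units.val_pow_eq_pow_val, hζ, Units.val_one])
    have hζk : ζ = Z ^ k := Units.ext (by rw [← hk, Units.val_pow_eq_pow_val])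
    have hX : (⟨Φ' (Additive.ofMul ζ), hmem' hζ⟩ : AddSubgroup.torsionBy (localPoints W'
        (v.adicCompletion K)) (p : ℤ)) =
        k • XZ := Subtype.ext (by
      rw [AddSubgroupClass.coe_nsmul, hXZ]
      change Φ' (Additive.ofMul ζ) = k • Φ' (Additive.ofMul Z)
      rw [hζk, ofMul_pow, map_nsmul])
    rw [hX, map_nsmul, ha, hζk, ← pow_mul, ofMul_pow, map_nsmul, mul_nsmul']
  -- the class `c` and a point `a'` trivialising it locally for `E'`
  obtain ⟨φ, rfl⟩ :=
    oneCocycleClass_surjective (discreteTopRep (absoluteGaloisGroup K) (geomTorsion W' (p : ℤ))) c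
  rw [selmerLocalKer, oneCocycleClass_mem_resKer_iff] at hc
  obtain ⟨a', ha'⟩ := hc
  have ha'' : ∀ σ : (absoluteGaloisGroup (v.adicCompletion K)), pointsMap W' (v.adicCompletion K)
      ((φ.1 (resGal (K := K) (v.adicCompletion K) σ) : geomTorsion W' (p : ℤ)) :
      geomPoints W') = σ • a' - a' := fun σ ↦ ha' σ
  -- `P' = p • a'` is `K_v`-rational, hence `= Φ'(u)` with `u ∈ K_v^*`
  have hP'fix : ∀ σ : (absoluteGaloisGroup (v.adicCompletion K)), σ • ((p : ℤ) • a') =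
      (p : ℤ) • a' := by
    intro σ
    have h0 : (p : ℤ) • (σ • a' - a') = 0 := by
      rw [← ha'' σ, ← map_zsmul, (mem_geomTorsion_iff W' _ _).mp (φ.1 _).2, map_zero]
    rw [W'.smul_zsmul_localPoints (p : ℤ) σ a']
    rw [zsmul_sub, sub_eq_zero] at h0
    exact h0
  obtain ⟨u, hu⟩ := hrat' ((p : ℤ) • a') hP'fix
  -- a `p`-th root `w` of `u`, the point `R' = Φ'(w)` with `p R' = P'`, and `T = a' - R' ∈ E'[p]`
  set uu : (AlgebraicClosure (v.adicCompletion K))ˣ := Units.map (algebraMap (v.adicCompletion K)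
      (AlgebraicClosure (v.adicCompletion K)) : (v.adicCompletion K) →* (AlgebraicClosure
      (v.adicCompletion K))) u with huu
  have huu0 : (uu : (AlgebraicClosure (v.adicCompletion K))) ≠ 0 := uu.ne_zero
  obtain ⟨z, hz⟩ := IsAlgClosed.exists_pow_nat_eq (uu : (AlgebraicClosure
      (v.adicCompletion K))) hpp.pos
  have hz0 : z ≠ 0 := by
    rintro rfl
    rw [zero_pow hpp.ne_zero] at hz
    exact huu0 hz.symm
  set w : (AlgebraicClosure (v.adicCompletion K))ˣ := Units.mk0 z hz0 with hw
  have hwp : w ^ p = uu := Units.ext (by rw [Units.val_pow_eq_pow_val, hw, Units.val_mk0, hz])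
  set R' : localPoints W' (v.adicCompletion K) := Φ' (Additive.ofMul w) with hR'
  have hR'p : (p : ℤ) • R' = (p : ℤ) • a' := by
    rw [hR', ← map_zsmul, ← ofMul_zpow, zpow_natCast, hwp, huu, hu]
  set T : localPoints W' (v.adicCompletion K) := a' - R' with hT
  have hTp : (p : ℤ) • T = 0 := by rw [hT, zsmul_sub, hR'p, sub_self]
  set Tt : AddSubgroup.torsionBy (localPoints W' (v.adicCompletion K)) (p : ℤ) :=
    ⟨T, (Submodule.mem_torsionBy_iff _ _).mpr hTp⟩ with hTt
  set T₀ : geomTorsion W' (p : ℤ) := e'.symm Tt with hT₀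
  have hT₀ : pointsMap W' (v.adicCompletion K) (T₀ : geomPoints W') = T := by
    rw [hT₀, he', W'.pointsMap_torsionPointsEquiv_symm (p : ℤ) hn Tt]
  -- `ζ_σ = σw / w` is a `p`-th root of unity (`σ` fixes `u ∈ K_v`)
  have hσuu : ∀ σ : (absoluteGaloisGroup (v.adicCompletion K)),
      (absoluteGaloisGroup.toAlgEquiv _ σ : AlgebraicClosure (v.adicCompletion K) →* AlgebraicClosure (v.adicCompletion K)) (uu :
      (AlgebraicClosure (v.adicCompletion K))) = uu := by
    intro σ
    rw [huu, Units.coe_map, MonoidHom.coe_coe, MonoidHom.coe_coe, AlgEquiv.commutes]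
  have hζσ : ∀ σ : (absoluteGaloisGroup (v.adicCompletion K)), (Units.map
      (absoluteGaloisGroup.toAlgEquiv _ σ : AlgebraicClosure (v.adicCompletion K)
      →* AlgebraicClosure (v.adicCompletion K)) w / w) ^ p = 1 := by
    intro σ
    apply Units.ext
    rw [Units.val_pow_eq_pow_val, Units.val_div_eq_div_val, div_pow, Units.coe_map, ← map_pow,
      ← Units.val_pow_eq_pow_val, hwp, hσuu, div_self huu0, Units.val_one]
  -- the cocycle of `E'`: `φ(σ) = e'⁻¹ Φ'(ζ_σ) + (σ T₀ - T₀)`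
  have hφσ : ∀ σ : (absoluteGaloisGroup (v.adicCompletion K)), φ.1 (resGal (K := K)
      (v.adicCompletion K) σ) =
      e'.symm ⟨Φ' (Additive.ofMul (Units.map
          (absoluteGaloisGroup.toAlgEquiv _ σ : AlgebraicClosure (v.adicCompletion K)
          →* AlgebraicClosure (v.adicCompletion K)) w / w)), hmem' (hζσ σ)⟩ +
        (resGal (K := K) (v.adicCompletion K) σ • T₀ - T₀) := by
    intro σ
    apply Subtype.ext
    apply pointsMapOfEmb_injective W' (closureEmb (K := K) (v.adicCompletion K))
    change pointsMap W' (v.adicCompletion K) _ = pointsMap W' (v.adicCompletion K) _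
    rw [ha'' σ, AddSubgroup.coe_add, AddSubgroup.coe_sub, map_add, map_sub,
      Literature.NumberTheory.EllipticCurves.AddSubgroup.torsionBy.coe_smul, pointsMap_smul, hT₀,
      he', W'.pointsMap_torsionPointsEquiv_symm (p : ℤ) hn]
    change σ • a' - a' = Φ' (Additive.ofMul (Units.map
        (absoluteGaloisGroup.toAlgEquiv _ σ : AlgebraicClosure (v.adicCompletion K)
        →* AlgebraicClosure (v.adicCompletion K)) w / w)) + (σ • T - T)
    rw [ofMul_div, map_sub, ← hequiv' σ w, ← hR', hT, smul_sub]
    abel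
  -- the witness for `E`: `b = Φ(w^a) + θ T₀`
  rw [h1Equiv_oneCocycleClass, selmerLocalKer, oneCocycleClass_mem_resKer_iff]
  refine ⟨Φ (Additive.ofMul (w ^ a)) +
    pointsMap W (v.adicCompletion K) ((θ T₀ : geomTorsion W (p : ℤ)) : geomPoints W), fun σ ↦ ?_⟩
  change pointsMap W (v.adicCompletion K) ((θ (φ.1 (resGal (K := K)
      (v.adicCompletion K) σ)) : geomTorsion W (p : ℤ)) :
    geomPoints W) = _
  have hmp : Units.map (absoluteGaloisGroup.toAlgEquiv _ σ : AlgebraicClosure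
      (v.adicCompletion K) →* AlgebraicClosure (v.adicCompletion K)) (w ^ a) = (Units.map
      (absoluteGaloisGroup.toAlgEquiv _ σ : AlgebraicClosure (v.adicCompletion K) →* AlgebraicClosure (v.adicCompletion K)) w) ^ a
      := map_pow _ w a
  have hdp : (Units.map (absoluteGaloisGroup.toAlgEquiv _ σ : AlgebraicClosure
      (v.adicCompletion K) →* AlgebraicClosure (v.adicCompletion K)) w / w) ^ a = (Units.map
      (absoluteGaloisGroup.toAlgEquiv _ σ : AlgebraicClosure (v.adicCompletion K)
      →* AlgebraicClosure (v.adicCompletion K)) w) ^ a / w ^ a := div_pow _ _ a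
  rw [hφσ σ, map_add, map_sub, AddSubgroup.coe_add, AddSubgroup.coe_sub, map_add, map_sub,
    ← hG_apply, hclaim _ (hζσ σ), hθ,
    Literature.NumberTheory.EllipticCurves.AddSubgroup.torsionBy.coe_smul, pointsMap_smul,
    smul_add, hequiv σ (w ^ a), hmp, hdp, ofMul_div, map_sub]
  abel

/-- **`ι_v(θ) = 1` at a place where both curves have split multiplicative reduction and
`#E(K_v)[p] ≤ p`** (the comparison index of `CongruenceVisibilityComparison.lean`), conditional
on Tate's uniformisation (`hU`). [cite: SilvermanATAEC1994, Ch. V Thm. 3.1, Thm. 5.3]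
[cite: CremonaMazur2000, §3] -/
theorem relIndex_map_selmerLocalKer_eq_one_of_hasSplitMultiplicativeReductionAt
    (hU : Silverman1994_thmV53_tateUniformisation.{0})
    (W' : WeierstrassCurve K) [W'.IsElliptic]
    (θ : geomTorsion W' (p : ℤ) ≃+ geomTorsion W (p : ℤ))
    (hθ : ∀ (σ : absoluteGaloisGroup K) (P : geomTorsion W' (p : ℤ)), θ (σ • P) = σ • θ P)
    (hW : W.HasSplitMultiplicativeReductionAt v) (hW' : W'.HasSplitMultiplicativeReductionAt v)
    (hcard : Nat.card (nsmulAddMonoidHom p : (W.baseChange (v.adicCompletion K)).toAffine.Point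
          →+ _).ker ≤ p) :
    (selmerLocalKer W (v.adicCompletion K) (p : ℤ)).relIndex
        ((selmerLocalKer W' (v.adicCompletion K) (p : ℤ)).map (h1Equiv θ hθ).toAddMonoidHom) = 1 :=
  (relIndex_map_selmerLocalKer_eq_one_iff W W' θ hθ).mpr fun _ hc ↦
    W.h1Equiv_mem_selmerLocalKer_of_hasSplitMultiplicativeReductionAt v hU W' θ hθ hW hW' hcard hc

/-- **Visible `Ш(E/K)[p] ≠ 0` from a `p`-congruent curve of rank `≥ 1`, with split multiplicative
places free of charge.** Let `p` be an odd prime, `θ : E'[p] ⥲ E[p]` a `Γ_K`-isomorphism, `S` a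
finite set of finite places outside which `E, E'` have good reduction and which contains the
places above `p`; assume `E(K)` is finite of order prime to `p`, `rank E'(K) ≥ 1`, and that every
`v ∈ S` is EITHER a place with `v ∤ p` and `E'(K_v)[p] = 0` OR a place at which both curves have
split multiplicative reduction and `#E(K_v)[p] ≤ p`. Then `Ш(E/K)` has a non-zero element killed
by `p`. (`exists_sha_ne_zero_of_congr_of_rank_of_le` with the agreement at the places of the second
kind supplied by `h1Equiv_mem_selmerLocalKer_of_hasSplitMultiplicativeReductionAt`; conditional on
Tate's uniformisation `hU`.) Over `ℚ` for a rank-`0` curve `E` with `p ∣ N_E` exactly once and a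
congruent `E'` of the same level: the place `p` and the split multiplicative primes `ℓ ≡ 1 (mod p)`
no longer force `rank E' ≥ 2, 3, …`. [cite: CremonaMazur2000, §3 and Table 1]
[cite: AgasheStein2002, Thm. 3.1 and §3.5] [cite: SilvermanATAEC1994, Ch. V Thm. 3.1, Thm. 5.3] -/
theorem exists_sha_ne_zero_of_congr_of_rank_of_split
    (hU : Silverman1994_thmV53_tateUniformisation.{0}) (hp2 : p ≠ 2)
    (W' : WeierstrassCurve K) [W'.IsElliptic]
    (θ : geomTorsion W' (p : ℤ) ≃+ geomTorsion W (p : ℤ))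
    (hθ : ∀ (σ : absoluteGaloisGroup K) (P : geomTorsion W' (p : ℤ)), θ (σ • P) = σ • θ P)
    (S : Finset (HeightOneSpectrum (𝓞 K)))
    (hS : ∀ w : HeightOneSpectrum (𝓞 K), w ∉ S →
      W.HasGoodReductionAt w ∧ W'.HasGoodReductionAt w ∧ (p : 𝓞 K) ∉ w.asIdeal)
    (hfin : Finite W.toAffine.Point) (hcop : (Nat.card W.toAffine.Point).Coprime p)
    (hrank : 1 ≤ W'.mordellWeilRank)
    (hplaces : ∀ w ∈ S,
      ((p : 𝓞 K) ∉ w.asIdeal ∧ Nat.card (nsmulAddMonoidHom p :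
          (W'.baseChange (w.adicCompletion K)).toAffine.Point →+ _).ker = 1) ∨
      (W.HasSplitMultiplicativeReductionAt w ∧ W'.HasSplitMultiplicativeReductionAt w ∧
        Nat.card (nsmulAddMonoidHom p :
          (W.baseChange (w.adicCompletion K)).toAffine.Point →+ _).ker ≤ p)) :
    ∃ c : W.sha, c ≠ 0 ∧ p • c = 0 := by
  refine exists_sha_ne_zero_of_congr_of_rank_of_le W W' hp2 θ hθ S hS hfin hcop hrank
    (fun w hw hcase c hc ↦ ?_)
  rcases hplaces w hw with ⟨hwp, hloc⟩ | ⟨hWw, hW'w, hcardw⟩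
  · exact absurd hcase (not_or.mpr ⟨hwp, not_not.mpr hloc⟩)
  · exact W.h1Equiv_mem_selmerLocalKer_of_hasSplitMultiplicativeReductionAt w hU W' θ hθ hWw hW'w
      hcardw hc

end Local

end WeierstrassCurve

end
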